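import Summits.ValiantsHypothesis.ValiantsHypothesis.Theorems.BarrierLeverNaturalProofsSeparateVNPProjections
import Summits.ValiantsHypothesis.ValiantsHypothesis.Theorems.BarrierLeverNaturalProofsSeparateVNPStatus
import Literature.Computability.AlgebraicComplexity.PermanentMonotone

/-!
# Route BarrierLever — item `NaturalProofsSeparateVNP` (stmt-ValiantsHypothesis-18972):
# PERMANENT NORMAL FORM — the item is an algebraically natural proof against `VP` AT THE PERMANENT
# (cell valiant-natproofs, seat val-np-p4; bears on ladder rung V4)

`S := Theses.BarrierLever.NaturalProofsSeparateVNP` (one `b₁`; for every size exponent `b`,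
infinitely often, a level-one natural proof against `SmallCircuits ℂ n b` with a non-root in the
`VNP`-succinct class `SmallDefinable ℂ n b₁`).  The sibling files normalise its parameters
(`b₁ = 1` suffices, `…ExponentOne`; the distinguisher level is immaterial, `…Level`;
`S ⇒ (per_n) ∉ \overline{VP}`, `…Border`).  This file normalises the TARGET: the existential "some
`VNP`-succinct non-root" may be replaced by THE PERMANENT, framed in FSV's regime as
`perFrame n := per_⌊√n⌋` renamed into the first `⌊√n⌋²` of the `n` variables (row-major) — written
out as `rename (Fin.castLE (Nat.sqrt_le n) ∘ finProdFinEquiv) (perPoly (Fin n.sqrt) ℂ)`; no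
definition is introduced.  With the barrier catalogue's technique class `NaturalProofAgainstVP`
(`Literature/Barriers/ValiantsHypothesis/AlgebraicNaturalProofs.lean`):

* `Permanent.naturalProofsSeparateVNP_iff_naturalProofAgainstVP_perFrame` —
  **`S ↔ NaturalProofAgainstVP ℂ 2 perFrame`**: item 18972 holds iff LEVEL-TWO algebraically
  natural proofs (size and degree `≤ N²`, `N = C(2n,n)`) certify, infinitely often against every
  polynomial size bound, that the permanent is not in `VP` — the natural-proofs analogue of
  "`VP ≠ VNP ⟺ (per_n) ∉ VP`"; the same at every level `a ≥ 2` (`…_level`), and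
  `NaturalProofAgainstVP ℂ a perFrame → S` for EVERY `a`
  (`naturalProofsSeparateVNP_of_naturalProofAgainstVP_perFrame`).
* `⇒`: the item's `VNP` target family (`naturalProofsSeparateVNP_iff_exists_family`) is a
  p-projection of the permanent by Valiant's completeness theorem, PROVED in the tree
  (`isVNPComplete_perPoly_holds`, `char ℂ ≠ 2`); pad `per_{t(n)} ≤_proj per_m`
  (`isProjection_perPoly_of_le`, `m = t(n)+n+1`), frame at `n' = m² > n`
  (`isProjection_perPoly_perFrame`), and let the natural proof ascend
  (`Projections.naturalProofAgainstVP_of_projections`, level `1 ↦ 2`).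
* `⇐`: `(per_n) ∈ VNP` (`isVNPFamily_perPoly_holds`, PROVED in the tree) puts `perFrame n` in
  `SmallDefinable ℂ n b₁` for all large `n` (`perFrame_mem_smallDefinable_eventually`, renaming the
  Boolean-sum witness, `boolSum_rename_sumMap`); the item's level is immaterial
  (`naturalProofsSeparateVNP_of_level`).
* normal-form corollaries: under `PermanentExpHardWith ℂ c m₀`,
  `NaturalProofAgainstVP ℂ 2 perFrame ↔ ¬ SuccinctHittingSetsForVP` (FSV Question 6 fails over `ℂ`
  iff natural proofs certify the hardness of the permanent); unconditionally
  `KRSTForVP ∨ NaturalProofAgainstVP ℂ 2 perFrame`; the crux forbids natural proofs at the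
  permanent at every level (`not_naturalProofAgainstVP_perFrame_of_crux`).

Level one in the `⇒` direction is not claimed: with `⌊√n⌋²` of the `n` frame variables live the
pulled-back linear forms alone cost more than `N'`; a sparser framing (e.g. `per_⌊n^{1/4}⌋`) would
be needed — and the item's own level is immaterial anyway (`…Level`).

WHAT THIS IS NOT: item 18972 stays OPEN (parked on the crux, item 14610); nothing here is evidence
for `VP ≠ VNP`, for FSV Question 6 either way, or for any hardness of the permanent — every
statement is an equivalence or implication between open statements.  That natural proofs transfer
along reductions is folklore (GKSS 2017 §2, FSV 2018 §1.2); new is only the kernel normal form of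
the tree's V4 statement.

References: [ForbesShpilkaVolk2018] Def. 1, §1.2, Cor. 5, Question 6; [Valiant1979];
[Burgisser2000] Def. 2.5–2.6, Rem. 2.7, Thm. 2.10; [BurgisserClausenShokrollahi1997] Thm. (21.17);
[KumarRamyaSaptharishiTengse2022] §1.2; [GrochowKumarSaksSaraf2017] §2.
-/

-- layout Summits/ValiantsHypothesis/ValiantsHypothesis forces the duplicated namespace component
set_option linter.dupNamespace false

noncomputable section

namespace Summit.ValiantsHypothesis.ValiantsHypothesis.Theorems.BarrierLever.NaturalProofsSeparateVNP

open Literature.Barriers.ValiantsHypothesis Literature.Computability.AlgebraicComplexity MvPolynomial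
open Summit.ValiantsHypothesis.ValiantsHypothesis.Theses
open Projections

namespace Permanent

/-! ### 1. The permanent, framed in the FSV regime -/

section Framing

/-- A polynomial is a projection of any of its renamings along an INJECTIVE map of variables
(send the image variables back, the others to `0`). [cite: Burgisser2000, Def. 2.6(1)] -/
theorem isProjection_rename_of_injective {σ τ : Type*} {ι : σ → τ} (hι : Function.Injective ι)
    (P : MvPolynomial σ ℂ) : IsProjection P (rename ι P) := by
  classical
  refine ⟨fun v => if h : ∃ i, ι i = v then X h.choose else C 0, fun v => ?_, ?_⟩
  · by_cases h : ∃ i, ι i = v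
    · exact Or.inl ⟨h.choose, by simp only [dif_pos h]⟩
    · exact Or.inr ⟨0, by simp only [dif_neg h]⟩
  · rw [aeval_rename]
    have hcomp : ((fun v => if h : ∃ i, ι i = v then X h.choose else (C 0 : MvPolynomial σ ℂ)) ∘ ι) =
        X := by
      funext i
      have h : ∃ j, ι j = ι i := ⟨i, rfl⟩
      rw [Function.comp_apply, dif_pos h, hι h.choose_spec]
    rw [hcomp, aeval_X_left, AlgHom.coe_id, id]

/-- The framing map `Fin s × Fin s → Fin n`, `s = ⌊√n⌋` (row-major into the first `s²` of the `n`
variables) is injective. [folklore] -/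
theorem frameEmb_injective (n : ℕ) :
    Function.Injective (Fin.castLE (Nat.sqrt_le n) ∘ (finProdFinEquiv : Fin n.sqrt × Fin n.sqrt ≃ _)) :=
  (Fin.castLE_injective _).comp finProdFinEquiv.injective

/-- The framed permanent `per_⌊√n⌋` (in the first `⌊√n⌋²` of `n` variables) has degree `⌊√n⌋ ≤ n`:
it lies in FSV's space of degree-`≤ n` polynomials in `n` variables. [cite: ForbesShpilkaVolk2018, §1.2] -/
theorem totalDegree_perFrame_le (n : ℕ) :
    (rename (Fin.castLE (Nat.sqrt_le n) ∘ finProdFinEquiv) (perPoly (Fin n.sqrt) ℂ)).totalDegree ≤ n := by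
  refine (totalDegree_rename_le _ _).trans ?_
  have h := (perPoly_isHomogeneous (n := Fin n.sqrt) (k := ℂ)).totalDegree_le
  rw [Fintype.card_fin] at h
  exact h.trans (Nat.sqrt_le_self n)

/-- `per_m` is a projection of the framed permanent at frame `m²` (there `⌊√(m²)⌋ = m`; pad by
`isProjection_perPoly_of_le`, then un-rename). [cite: Burgisser2000, Def. 2.6] -/
theorem isProjection_perPoly_perFrame (m : ℕ) :
    IsProjection (perPoly (Fin m) ℂ)
      (rename (Fin.castLE (Nat.sqrt_le (m * m)) ∘ finProdFinEquiv) (perPoly (Fin (m * m).sqrt) ℂ)) :=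
  IsProjection.trans_holds (isProjection_perPoly_of_le ℂ (Nat.sqrt_eq m).ge)
    (isProjection_rename_of_injective (frameEmb_injective (m * m)) _)

/-- Absorbing constants: `A (n+1)^B ≤ n^(B+1)` for `n ≥ A · 2^B + 1`. [folklore] -/
theorem poly_absorb (A B : ℕ) : ∀ n : ℕ, A * 2 ^ B + 1 ≤ n → A * (n + 1) ^ B ≤ n ^ (B + 1) := by
  intro n hn
  have h1 : (n + 1) ^ B ≤ 2 ^ B * n ^ B := by
    calc (n + 1) ^ B ≤ (2 * n) ^ B := Nat.pow_le_pow_left (by omega) B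
      _ = 2 ^ B * n ^ B := mul_pow 2 n B
  calc A * (n + 1) ^ B ≤ A * (2 ^ B * n ^ B) := Nat.mul_le_mul_left A h1
    _ = (A * 2 ^ B) * n ^ B := by ring
    _ ≤ n * n ^ B := Nat.mul_le_mul_right _ (by omega)
    _ = n ^ (B + 1) := by ring

/-- **The framed permanent is eventually in the `VNP`-succinct class** `SmallDefinable ℂ n b₁` for
ONE exponent `b₁` (Valiant 1979: `(per_n) ∈ VNP`, the tree's `isVNPFamily_perPoly_holds`; rename
the Boolean-sum witness into the frame, `boolSum_rename_sumMap`). [cite: Valiant1979]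
[cite: Burgisser2000, Def. 2.5 and Thm. 2.10] -/
theorem perFrame_mem_smallDefinable_eventually :
    ∃ b₁ n₁ : ℕ, ∀ n : ℕ, n₁ ≤ n →
      rename (Fin.castLE (Nat.sqrt_le n) ∘ finProdFinEquiv) (perPoly (Fin n.sqrt) ℂ) ∈
        SmallDefinable ℂ n b₁ := by
  obtain ⟨-, u, g, ⟨⟨hcard, hgdeg⟩, hgcomp⟩, hgeq⟩ := isVNPFamily_perPoly_holds ℂ
  obtain ⟨A₁, B₁, h₁⟩ := (IsPBounded.iff_exists_le_mul_succ_pow _).1 hcard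
  obtain ⟨A₂, B₂, h₂⟩ := (IsPBounded.iff_exists_le_mul_succ_pow _).1 hgdeg
  obtain ⟨A₃, B₃, h₃⟩ := (IsPBounded.iff_exists_le_mul_succ_pow _).1 hgcomp
  set A := A₁ + A₂ + A₃ with hA
  set B := B₁ + B₂ + B₃ with hB
  refine ⟨B + 1, A * 2 ^ B + 1, fun n hn => ?_⟩
  set s := n.sqrt with hs
  have hsn : s ≤ n := Nat.sqrt_le_self n
  -- every witness parameter at `s` is `≤ A (s+1)^B ≤ A (n+1)^B ≤ n^(B+1)`
  have absorb : ∀ {q Aᵢ Bᵢ : ℕ}, q ≤ Aᵢ * (s + 1) ^ Bᵢ → Aᵢ ≤ A → Bᵢ ≤ B → q ≤ n ^ (B + 1) := by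
    intro q Aᵢ Bᵢ hq hAᵢ hBᵢ
    calc q ≤ Aᵢ * (s + 1) ^ Bᵢ := hq
      _ ≤ A * (n + 1) ^ B := Nat.mul_le_mul hAᵢ
          ((Nat.pow_le_pow_left (by omega) _).trans (Nat.pow_le_pow_right (by omega) hBᵢ))
      _ ≤ n ^ (B + 1) := poly_absorb A B n hn
  have hu : u s ≤ n ^ (B + 1) := by
    refine absorb ((?_ : u s ≤ _).trans (h₁ s)) (by omega) (by omega)
    rw [Fintype.card_sum, Fintype.card_fin]
    exact Nat.le_add_left _ _
  refine ⟨totalDegree_perFrame_le n, u s, hu,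
    rename (Sum.map (Fin.castLE (Nat.sqrt_le n) ∘ finProdFinEquiv) id) (g s), ?_, ?_, ?_⟩
  · exact absorb ((complexity_rename_le_holds' _ _).trans (h₃ s)) (by omega) (by omega)
  · exact absorb ((totalDegree_rename_le _ _).trans (h₂ s)) (by omega) (by omega)
  · rw [boolSum_rename_sumMap, ← hgeq s]

end Framing

/-! ### 2. The item is a natural proof against `VP` at the permanent -/

section Main

/-- **Item 18972 ⇒ a level-two algebraically natural proof that the permanent is not in `VP`.**
The item's `VNP` target family (`naturalProofsSeparateVNP_iff_exists_family`) is a p-projection of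
the permanent (Valiant's completeness theorem, PROVED in the tree: `isVNPComplete_perPoly_holds`,
`char ℂ ≠ 2`); pad `per_{t(n)}` to `per_m`, `m = t(n)+n+1`, frame it at `n' = m² > n`, and let the
natural proof ascend (`naturalProofAgainstVP_of_projections`).
[cite: Valiant1979] [cite: ForbesShpilkaVolk2018, Def. 1 and §1.2] -/
theorem naturalProofAgainstVP_perFrame_of_naturalProofsSeparateVNP
    (hS : BarrierLever.NaturalProofsSeparateVNP) :
    NaturalProofAgainstVP ℂ 2
      (fun n => rename (Fin.castLE (Nat.sqrt_le n) ∘ finProdFinEquiv) (perPoly (Fin n.sqrt) ℂ)) := by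
  obtain ⟨h, hdef, hnat⟩ := naturalProofsSeparateVNP_iff_exists_family.mp hS
  have h2 : ringChar ℂ ≠ 2 := by rw [ringChar.eq_zero]; decide
  obtain ⟨t, ht, hpr⟩ : IsPProjection h fun n => perPoly (Fin n) ℂ :=
    (isVNPComplete_perPoly_holds ℂ h2).2 (fun n => n) h (Border.isVNPFamily_of_mem_smallDefinable_one hdef)
  obtain ⟨A, B, hAB⟩ := (IsPBounded.iff_exists_le_mul_succ_pow t).1 ht
  have key := naturalProofAgainstVP_of_projections (a := 1) hnat
    (P := fun n => rename (Fin.castLE (Nat.sqrt_le n) ∘ finProdFinEquiv) (perPoly (Fin n.sqrt) ℂ))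
    ⟨(A + 1) ^ 2, 2 * B + 2, fun n => ?_⟩
  · exact key
  set m := t n + n + 1 with hm
  refine ⟨m * m, ?_, ?_, totalDegree_perFrame_le (m * m), ?_⟩
  · calc n < (n + 1) * (n + 1) := by nlinarith
      _ ≤ m * m := Nat.mul_le_mul (by omega) (by omega)
  · have hm' : m ≤ (A + 1) * (n + 1) ^ (B + 1) := by
      have h1 : (n + 1) ^ B ≤ (n + 1) ^ (B + 1) := Nat.pow_le_pow_right (by omega) (by omega)
      have h2 : n + 1 ≤ (n + 1) ^ (B + 1) := by
        calc n + 1 = (n + 1) ^ 1 := (pow_one _).symm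
          _ ≤ (n + 1) ^ (B + 1) := Nat.pow_le_pow_right (by omega) (by omega)
      calc m = t n + (n + 1) := by rw [hm]; ring
        _ ≤ A * (n + 1) ^ B + (n + 1) := Nat.add_le_add_right (hAB n) _
        _ ≤ A * (n + 1) ^ (B + 1) + (n + 1) ^ (B + 1) := Nat.add_le_add (Nat.mul_le_mul_left A h1) h2
        _ = (A + 1) * (n + 1) ^ (B + 1) := by ring
    calc m * m ≤ ((A + 1) * (n + 1) ^ (B + 1)) * ((A + 1) * (n + 1) ^ (B + 1)) :=
          Nat.mul_le_mul hm' hm'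
      _ = (A + 1) ^ 2 * (n + 1) ^ (2 * B + 2) := by ring
  · exact IsProjection.trans_holds
      (IsProjection.trans_holds (hpr n) (isProjection_perPoly_of_le ℂ (by omega : t n ≤ m)))
      (isProjection_perPoly_perFrame m)

/-- **Conversely, at ANY level**: an algebraically natural proof of level `a` that the framed
permanent is not in `VP` gives item 18972 — the permanent is eventually in `SmallDefinable ℂ n b₁`
(`perFrame_mem_smallDefinable_eventually`) and the item's level is immaterial
(`naturalProofsSeparateVNP_of_level`). [cite: Valiant1979] [cite: ForbesShpilkaVolk2018, Question 6] -/
theorem naturalProofsSeparateVNP_of_naturalProofAgainstVP_perFrame (a : ℕ)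
    (hnat : NaturalProofAgainstVP ℂ a
      (fun n => rename (Fin.castLE (Nat.sqrt_le n) ∘ finProdFinEquiv) (perPoly (Fin n.sqrt) ℂ))) :
    BarrierLever.NaturalProofsSeparateVNP := by
  obtain ⟨b₁, n₁, hmem⟩ := perFrame_mem_smallDefinable_eventually
  refine naturalProofsSeparateVNP_of_level a ⟨b₁, fun b n₀ => ?_⟩
  obtain ⟨n, hn, D, hD, hne⟩ := hnat b (max n₀ n₁)
  exact ⟨n, (le_max_left _ _).trans hn, D, hD, _, hmem n ((le_max_right _ _).trans hn), hne⟩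

/-- **PERMANENT NORMAL FORM of item 18972.** `NaturalProofsSeparateVNP` holds iff there is a
level-two algebraically natural proof against `VP` AT THE PERMANENT (FSV regime: for every size
exponent `b`, infinitely often in `n`, a distinguisher of size and degree `≤ N²`, `N = C(2n,n)`,
vanishing on the coefficient vectors of `SmallCircuits ℂ n b` and nonzero at `per_⌊√n⌋` framed in
the first `⌊√n⌋²` variables) — the barrier catalogue's technique class `NaturalProofAgainstVP`
(AlgebraicNaturalProofs.lean) at its intended target. The natural-proofs analogue of
"`VP ≠ VNP ⟺ (per_n) ∉ VP`". [cite: Valiant1979] [cite: ForbesShpilkaVolk2018, Def. 1, §1.2 and Question 6] -/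
theorem naturalProofsSeparateVNP_iff_naturalProofAgainstVP_perFrame :
    BarrierLever.NaturalProofsSeparateVNP ↔ NaturalProofAgainstVP ℂ 2
      (fun n => rename (Fin.castLE (Nat.sqrt_le n) ∘ finProdFinEquiv) (perPoly (Fin n.sqrt) ℂ)) :=
  ⟨naturalProofAgainstVP_perFrame_of_naturalProofsSeparateVNP,
    naturalProofsSeparateVNP_of_naturalProofAgainstVP_perFrame 2⟩

/-- The same at every level `a ≥ 2` (levels are monotone). [cite: ForbesShpilkaVolk2018, Cor. 5] -/
theorem naturalProofsSeparateVNP_iff_naturalProofAgainstVP_perFrame_level {a : ℕ} (ha : 2 ≤ a) :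
    BarrierLever.NaturalProofsSeparateVNP ↔ NaturalProofAgainstVP ℂ a
      (fun n => rename (Fin.castLE (Nat.sqrt_le n) ∘ finProdFinEquiv) (perPoly (Fin n.sqrt) ℂ)) :=
  ⟨fun hS => naturalProofAgainstVP_mono ha (naturalProofAgainstVP_perFrame_of_naturalProofsSeparateVNP hS),
    naturalProofsSeparateVNP_of_naturalProofAgainstVP_perFrame a⟩

/-- **Under exponential hardness of the permanent**: FSV Question 6 FAILS over `ℂ` (the crux, item
14610, is false — `VP` has efficiently constructible equations infinitely often) iff algebraically
natural proofs (level two) certify that the permanent is not in `VP` — combine the normal form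
with the tree's `naturalProofsSeparateVNP_iff_not_crux` (KRST 2022 win–win).
[cite: KumarRamyaSaptharishiTengse2022, Thm. MainThm and §1.2] [cite: ForbesShpilkaVolk2018, Question 6] -/
theorem naturalProofAgainstVP_perFrame_iff_not_crux {c m₀ : ℕ} (hper : PermanentExpHardWith ℂ c m₀) :
    NaturalProofAgainstVP ℂ 2
        (fun n => rename (Fin.castLE (Nat.sqrt_le n) ∘ finProdFinEquiv) (perPoly (Fin n.sqrt) ℂ)) ↔
      ¬ BarrierLever.SuccinctHittingSetsForVP :=
  naturalProofsSeparateVNP_iff_naturalProofAgainstVP_perFrame.symm.trans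
    (naturalProofsSeparateVNP_iff_not_crux hper)

/-- **Unconditionally**: item 18967 `KRSTForVP` holds, or algebraically natural proofs of level two
certify `per ∉ VP` infinitely often (the tree's dichotomy `naturalProofsSeparateVNP_or_krstForVP`
in normal form). [cite: KumarRamyaSaptharishiTengse2022, §1.2] -/
theorem krstForVP_or_naturalProofAgainstVP_perFrame :
    BarrierLever.KRSTForVP ∨ NaturalProofAgainstVP ℂ 2
      (fun n => rename (Fin.castLE (Nat.sqrt_le n) ∘ finProdFinEquiv) (perPoly (Fin n.sqrt) ℂ)) := by
  rcases naturalProofsSeparateVNP_or_krstForVP with hS | hK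
  · exact Or.inr (naturalProofAgainstVP_perFrame_of_naturalProofsSeparateVNP hS)
  · exact Or.inl hK

/-- And the crux (item 14610) forbids natural proofs against `VP` at the permanent at every level
(the barrier catalogue's conditional no-go `not_naturalProofAgainstVP`, recorded here at the
framed permanent). [cite: ForbesShpilkaVolk2018, Cor. 5 and Question 6] -/
theorem not_naturalProofAgainstVP_perFrame_of_crux (hQ : BarrierLever.SuccinctHittingSetsForVP) (a : ℕ) :
    ¬ NaturalProofAgainstVP ℂ a
      (fun n => rename (Fin.castLE (Nat.sqrt_le n) ∘ finProdFinEquiv) (perPoly (Fin n.sqrt) ℂ)) :=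
  fun hnat => not_naturalProofsSeparateVNP_of_crux hQ
    (naturalProofsSeparateVNP_of_naturalProofAgainstVP_perFrame a hnat)

end Main

end Permanent

end Summit.ValiantsHypothesis.ValiantsHypothesis.Theorems.BarrierLever.NaturalProofsSeparateVNP

end
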